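import Summits.AtomisticToContinuum.FouriersLaw.Theses.HonestZwanzig
import Summits.AtomisticToContinuum.FouriersLaw.Theorems.HonestZwanzigOrthogonalOhmRegressionIdentity
import Summits.AtomisticToContinuum.FouriersLaw.Theorems.HonestZwanzigOrthogonalOhmContactIdentity

/-!
# OrthogonalOhm — KERNEL-FORM skeleton (line Sketch, lead's alternative composition for the planner; NOT registered)

The crux `HonestZwanzig.OrthogonalOhm` follows from the memory-kernel packaging of the open content isolated by line
`Sketch` (see `Lines/Sketch.md`, `Lines/SketchResiduals.lean`):
* `stub_feshbachIdentities` (R0, route item stmt-12697) — only for second-slot linearity `schur_s(j_b, J) = Σ_c schur_s(j_b, j_c)`;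
* `stub_memoryKernelLocality` (K1) — N-uniformly summable rows of the clamped memory kernel `𝔎_N(0)_{bc} = lim schur_s(j_b,j_c)`;
* `stub_memoryKernelBulkLimit` (K2) — bulk row sums equal one constant `k` up to `ε`;
* `stub_clampedContactLocality` (C = R3′ of the registered skeleton) — summable clamped contact responses;
plus the LANDED identity `stub_contactIdentity` (S3, p98711). No regression identity, no `reg`, no `FixedNLap` is needed for this
composition (existence of limits is part of K1 and C). This file documents that the registered stub R2 (`stub_bulkRegressionOhm`)
and the pair (K1, K2) carry the same open content; it is evidence for the `promote-stub` recommendation, not a second line.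
-/

namespace Summit.AtomisticToContinuum.FouriersLaw.Theorems.HonestZwanzig.OrthogonalOhmLine.KernelForm

open MeasureTheory Filter Topology
open Literature.MathematicalPhysics.KineticTheory.HeatConduction
open Summit.AtomisticToContinuum.FouriersLaw.Theorems.HonestZwanzig.NetworkReduction
open Summit.AtomisticToContinuum.FouriersLaw.Theorems.HonestZwanzig.OrthogonalOhmLine.RegressionIdentity

/-- R0 (route item stmt-12697). -/
theorem stub_feshbachIdentities : Summit.AtomisticToContinuum.FouriersLaw.Theses.HonestZwanzig.FeshbachIdentities := by
  sorry

/-- (K1) MemoryKernelLocality — see `Lines/SketchResiduals.lean`. -/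
theorem stub_memoryKernelLocality :
    ∀ ω₂ lam β γ : ℝ, 0 < ω₂ → 0 < lam → 0 < β → 0 < γ → ∀ T : ℝ, 0 < T → ∃ C : ℝ, ∀ ε : ℝ, 0 < ε → ∃ R : ℕ, ∀ N : ℕ, 2 ≤ N → let P := Literature.MathematicalPhysics.KineticTheory.HeatConduction.pinnedChain ω₂ lam β γ; let X := Literature.MathematicalPhysics.KineticTheory.HeatConduction.PhaseSpace N; let μ : MeasureTheory.Measure X := P.gibbsMeasure N T; let corr : (X → ℝ) → (X → ℝ) → ℝ → ℝ := fun f g t => (∫ z, f z * (∫ y, g y ∂(P.transitionKernel N T T t.toNNReal z)) ∂μ) - (∫ z, f z ∂μ) * (∫ z, g z ∂μ); let lap : ℝ → (X → ℝ) → (X → ℝ) → ℝ := fun s f g => ∫ t in Set.Ioi (0 : ℝ), Real.exp (-(s * t)) * corr f g t; let e : Fin N → X → ℝ := fun x z => z.2 x ^ 2 / 2 + P.U (z.1 x) + ∑ j : Fin N, ((if j.val = x.val + 1 then P.V (z.1 j - z.1 x) / 2 else 0) + (if x.val = j.val + 1 then P.V (z.1 x - z.1 j) / 2 else 0)); let G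 : ℝ → Matrix (Fin N) (Fin N) ℝ := fun s => Matrix.of fun x y => lap s (e x) (e y); let schur : ℝ → (X → ℝ) → (X → ℝ) → ℝ := fun s f g => lap s f g - ∑ x : Fin N, ∑ y : Fin N, lap s f (e x) * (G s)⁻¹ x y * lap s (e y) g; ∃ K : Fin N → Fin N → ℝ, (∀ b c : Fin N, Filter.Tendsto (fun s => schur s (P.bondCurrent N b) (P.bondCurrent N c)) (nhdsWithin (0 : ℝ) (Set.Ioi 0)) (nhds (K b c))) ∧ (∀ b : Fin N, (∑ c : Fin N, (1 + |((c.val : ℝ) - b.val)|) * |K b c|) ≤ C) ∧ (∀ b : Fin N, (∑ c : Fin N, if R ≤ Int.natAbs ((c.val : ℤ) - b.val) then |K b c| else 0) ≤ ε) := by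
  sorry

/-- (K2) MemoryKernelBulkLimit — see `Lines/SketchResiduals.lean`. -/
theorem stub_memoryKernelBulkLimit :
    ∀ ω₂ lam β γ : ℝ, 0 < ω₂ → 0 < lam → 0 < β → 0 < γ → ∀ T : ℝ, 0 < T → ∃ k : ℝ, ∀ ε : ℝ, 0 < ε → ∃ R : ℕ, ∀ N : ℕ, 2 ≤ N → let P := Literature.MathematicalPhysics.KineticTheory.HeatConduction.pinnedChain ω₂ lam β γ; let X := Literature.MathematicalPhysics.KineticTheory.HeatConduction.PhaseSpace N; let μ : MeasureTheory.Measure X := P.gibbsMeasure N T; let corr : (X → ℝ) → (X → ℝ) → ℝ → ℝ := fun f g t => (∫ z, f z * (∫ y, g y ∂(P.transitionKernel N T T t.toNNReal z)) ∂μ) - (∫ z, f z ∂μ) * (∫ z, g z ∂μ); let lap : ℝ → (X → ℝ) → (X → ℝ) → ℝ := fun s f g => ∫ t in Set.Ioi (0 : ℝ), Real.exp (-(s * t)) * corr f g t; let e : Fin N → X → ℝ := fun x z => z.2 x ^ 2 / 2 + P.U (z.1 x) + ∑ j : Fin N, ((if j.val = x.val + 1 then P.V (z.1 j - z.1 x)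 / 2 else 0) + (if x.val = j.val + 1 then P.V (z.1 x - z.1 j) / 2 else 0)); let G : ℝ → Matrix (Fin N) (Fin N) ℝ := fun s => Matrix.of fun x y => lap s (e x) (e y); let schur : ℝ → (X → ℝ) → (X → ℝ) → ℝ := fun s f g => lap s f g - ∑ x : Fin N, ∑ y : Fin N, lap s f (e x) * (G s)⁻¹ x y * lap s (e y) g; ∀ b : Fin N, R ≤ b.val → b.val + 2 + R ≤ N → ∀ ρ : ℝ, Filter.Tendsto (fun s => ∑ c : Fin N, schur s (P.bondCurrent N b) (P.bondCurrent N c)) (nhdsWithin (0 : ℝ) (Set.Ioi 0)) (nhds ρ) → |ρ - k| ≤ ε := by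
  sorry

/-- (C) = R3′ of the registered skeleton, verbatim. -/
theorem stub_clampedContactLocality :
    ∀ ω₂ lam β γ : ℝ, 0 < ω₂ → 0 < lam → 0 < β → 0 < γ → ∀ T : ℝ, 0 < T → ∃ C : ℝ, ∀ ε : ℝ, 0 < ε → ∃ R : ℕ, ∀ N : ℕ, ∀ hN : 2 ≤ N, let P := Literature.MathematicalPhysics.KineticTheory.HeatConduction.pinnedChain ω₂ lam β γ; let X := Literature.MathematicalPhysics.KineticTheory.HeatConduction.PhaseSpace N; let μ : MeasureTheory.Measure X := P.gibbsMeasure N T; let corr : (X → ℝ) → (X → ℝ) → ℝ → ℝ := fun f g t => (∫ z, f z * (∫ y, g y ∂(P.transitionKernel N T T t.toNNReal z)) ∂μ) - (∫ z, f z ∂μ) * (∫ z, g z ∂μ); let lap : ℝ → (X → ℝ) → (X → ℝ) → ℝ := fun s f g => ∫ t in Set.Ioi (0 : ℝ), Real.exp (-(s * t)) * corr f g t; let e : Fin N → X → ℝ := fun x z => z.2 x ^ 2 / 2 + P.U (z.1 x) + ∑ j : Fin N, ((if j.val = x.val + 1 then P.V (z.1 j - z.1 x) / 2 else 0) + (if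 x.val = j.val + 1 then P.V (z.1 x - z.1 j) / 2 else 0)); let G : ℝ → Matrix (Fin N) (Fin N) ℝ := fun s => Matrix.of fun x y => lap s (e x) (e y); let schur : ℝ → (X → ℝ) → (X → ℝ) → ℝ := fun s f g => lap s f g - ∑ x : Fin N, ∑ y : Fin N, lap s f (e x) * (G s)⁻¹ x y * lap s (e y) g; ∃ ω₀ ω₁ : Fin N → ℝ,
      (∑ b : Fin N, |ω₀ b|) ≤ C ∧ (∑ b : Fin N, |ω₁ b|) ≤ C ∧ ∀ b : Fin N,
        Filter.Tendsto (fun s => schur s (P.bondCurrent N b) (fun w => w.2 ⟨0, by omega⟩ ^ 2))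
            (nhdsWithin (0 : ℝ) (Set.Ioi 0)) (nhds (ω₀ b)) ∧
          Filter.Tendsto (fun s => schur s (P.bondCurrent N b) (fun w => w.2 ⟨N - 1, by omega⟩ ^ 2))
            (nhdsWithin (0 : ℝ) (Set.Ioi 0)) (nhds (ω₁ b)) ∧
          (b.val : ℝ) * |ω₀ b| ≤ C ∧ (((N : ℝ) - 1) - b.val) * |ω₁ b| ≤ C ∧
          (R ≤ b.val → (b.val : ℝ) * |ω₀ b| ≤ ε) ∧ (b.val + 2 + R ≤ N → (((N : ℝ) - 1) - b.val) * |ω₁ b| ≤ ε) := by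
  sorry

/-- **OrthogonalOhm from the kernel form**: R0 + K1 + K2 + C (+ the landed S3) imply the crux BY NAME. Bond clause:
`ρ_b := Σ_c 𝔎_{bc}`, the limit of `schur_s(j_b, J) = Σ_c schur_s(j_b, j_c)` (second-slot linearity, `schur_lincomb_right` +
`lapR_sum` from the RegressionIdentity file under R0), `|ρ_b| ≤ Σ_c (1+|c−b|)|𝔎_{bc}| ≤ C₁`, bulk `|ρ_b − k| ≤ ε` from K2 applied
to that limit; contact clause: `w = −Σ_b ω(b)` via S3, `|w| ≤ Σ|ω| ≤ C₃`. -/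
theorem orthogonalOhm_of_kernelForm : Summit.AtomisticToContinuum.FouriersLaw.Theses.HonestZwanzig.OrthogonalOhm := by
  have h0 := stub_feshbachIdentities
  have hK1 := stub_memoryKernelLocality
  have hK2 := stub_memoryKernelBulkLimit
  have h3 := stub_clampedContactLocality
  have h4 := stub_contactIdentity
  intro ω₂ lam β γ hω hl hβ hγ T hT
  obtain ⟨C₁, hC₁⟩ := hK1 ω₂ lam β γ hω hl hβ hγ T hT
  obtain ⟨k, hk⟩ := hK2 ω₂ lam β γ hω hl hβ hγ T hT
  obtain ⟨C₃, hC₃⟩ := h3 ω₂ lam β γ hω hl hβ hγ T hT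
  refine ⟨k, max C₁ C₃, fun ε hε => ?_⟩
  obtain ⟨R₁, hR₁⟩ := hC₁ 1 one_pos
  obtain ⟨R₂, hR₂⟩ := hk ε hε
  obtain ⟨R₃, hR₃⟩ := hC₃ ε hε
  refine ⟨R₂, fun N hN => ?_⟩
  intro P X μ corr lap e G schur J
  obtain ⟨-, hFI2, -, -⟩ := h0 ω₂ lam β γ hω hl hβ hγ T hT N hN
  -- second-slot linearity on the bond currents, at every `s ≥ 0`
  have hlapJ : ∀ s : ℝ, 0 ≤ s → ∀ f : X → ℝ,
      (Continuous f ∧ ∃ A : ℝ, ∀ z, |f z| ≤ A * Real.exp (P.hamiltonian N z / (8 * T))) →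
      lap s f J = (∑ c : Fin N, 1 * lap s f (P.bondCurrent N c)) + 0 * lap s f (fun _ => 0) + 0 * lap s f (fun _ => 0) := by
    intro s hs f hf
    have hJ1 : J = fun z => ∑ c : Fin N, (1 : ℝ) * P.bondCurrent N c z := by
      funext z; simp only [one_mul]; rfl
    rw [hJ1, zero_mul, add_zero, add_zero]
    exact lapR_sum (ω₂ := ω₂) (lam := lam) (β := β) (γ := γ) (N := N) (T := T)
      (Adm := fun f => Continuous f ∧ ∃ A : ℝ, ∀ z, |f z| ≤ A * Real.exp (P.hamiltonian N z / (8 * T)))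
      (corr := corr) (lap := lap) (cov := fun f g => (∫ z, f z * g z ∂μ) - (∫ z, f z ∂μ) * (∫ z, g z ∂μ)) (e := e)
      (fun f => Iff.rfl) (fun f g t => rfl) (fun s f g => rfl) hFI2 hω hl.le hβ.le hT (fun _ => 1) (P.bondCurrent N)
      (fun c => adm_bondCurrent _ (fun f => Iff.rfl) hω hl.le hβ.le hT c) hf hs
  have hlin : ∀ s : ℝ, 0 ≤ s → ∀ b : Fin N,
      schur s (P.bondCurrent N b) J = ∑ c : Fin N, schur s (P.bondCurrent N b) (P.bondCurrent N c) := by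
    intro s hs b
    have h := schur_lincomb_right (lap s) (schur s) e (G s) (fun f g => rfl) (fun _ => 1) 0 0
      (P.bondCurrent N b) J (fun _ => 0) (fun _ => 0) (P.bondCurrent N)
      (hlapJ s hs _ (adm_bondCurrent _ (fun f => Iff.rfl) hω hl.le hβ.le hT b))
      (fun u => hlapJ s hs _ (adm_e _ (fun f => Iff.rfl) e (fun x z => rfl) hω hl.le hβ.le hT u))
    simpa only [one_mul, zero_mul, add_zero] using h
  refine ⟨fun b hb => ?_, fun b hb => ?_⟩
  · obtain ⟨K, hKlim, hKsum, -⟩ := hR₁ N hN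
    have hρ : Filter.Tendsto (fun s => schur s (P.bondCurrent N b) J) (nhdsWithin (0 : ℝ) (Set.Ioi 0))
        (nhds (∑ c : Fin N, K b c)) := by
      refine (tendsto_finsetSum _ fun c _ => hKlim b c).congr' ?_
      filter_upwards [self_mem_nhdsWithin] with s hs
      exact (hlin s (le_of_lt hs) b).symm
    refine ⟨∑ c : Fin N, K b c, hρ, ?_, fun hRb hbR => hR₂ N hN b hRb hbR _ ?_⟩
    · refine le_trans ?_ (le_max_left _ _)
      refine (Finset.abs_sum_le_sum_abs _ _).trans (le_trans (Finset.sum_le_sum fun c _ => ?_) (hKsum b))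
      have h1 : (0 : ℝ) ≤ |((c.val : ℝ) - b.val)| := abs_nonneg _
      nlinarith [abs_nonneg (K b c)]
    · refine hρ.congr' ?_
      filter_upwards [self_mem_nhdsWithin] with s hs
      exact hlin s (le_of_lt hs) b
  · -- contact clause: S3 identity + R3′ summability
    obtain ⟨ω₀f, ω₁f, hS₀, hS₁, hall⟩ := hR₃ N hN
    have hid4 := fun s (hs : 0 < s) => h4 h0 ω₂ lam β γ hω hl hβ hγ T hT N hN s hs
    rcases hb with hb0 | hbN
    · have h0N : 0 < N := by omega
      have hbeq : b = ⟨0, h0N⟩ := Fin.ext hb0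
      subst hbeq
      refine ⟨-(∑ b' : Fin N, ω₀f b'), ?_, ?_⟩
      · have hlim : Filter.Tendsto
            (fun s => -(∑ b' : Fin N, schur s (P.bondCurrent N b') (fun w => w.2 (⟨0, by omega⟩ : Fin N) ^ 2)))
            (nhdsWithin (0 : ℝ) (Set.Ioi 0)) (nhds (-(∑ b' : Fin N, ω₀f b'))) :=
          (tendsto_finsetSum _ fun b' _ => (hall b').1).neg
        refine hlim.congr' ?_
        filter_upwards [self_mem_nhdsWithin] with s hs
        exact ((hid4 s hs).1).symm
      · refine le_trans ?_ (le_max_right _ _)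
        rw [abs_neg]
        exact (Finset.abs_sum_le_sum_abs _ _).trans hS₀
    · have hN1 : N - 1 < N := by omega
      have hbeq : b = ⟨N - 1, hN1⟩ := Fin.ext hbN
      subst hbeq
      refine ⟨-(∑ b' : Fin N, ω₁f b'), ?_, ?_⟩
      · have hlim : Filter.Tendsto
            (fun s => -(∑ b' : Fin N, schur s (P.bondCurrent N b') (fun w => w.2 (⟨N - 1, by omega⟩ : Fin N) ^ 2)))
            (nhdsWithin (0 : ℝ) (Set.Ioi 0)) (nhds (-(∑ b' : Fin N, ω₁f b'))) :=
          (tendsto_finsetSum _ fun b' _ => (hall b').2.1).neg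
        refine hlim.congr' ?_
        filter_upwards [self_mem_nhdsWithin] with s hs
        exact ((hid4 s hs).2).symm
      · refine le_trans ?_ (le_max_right _ _)
        rw [abs_neg]
        exact (Finset.abs_sum_le_sum_abs _ _).trans hS₁


end Summit.AtomisticToContinuum.FouriersLaw.Theorems.HonestZwanzig.OrthogonalOhmLine.KernelForm
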